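import Mathlib.Analysis.SpecialFunctions.Pow.Real
import Mathlib.Algebra.BigOperators.Ring.Finset
import Literature.Computability.Complexity.RandomCNF
import Literature.Computability.Cryptography.OneWayFunctions
import HarnessLib

/-!
# Named fact: polynomial-time refutation of random `k`-SAT with `Õ(n^{k/2})` clauses
(Allen–O'Donnell–Witmer 2015)

Trunk T-CPLX-CORE (Literature/Computability/Complexity); cite item `wi-03698` (route PneNP/Feige:
delimits the thesis, which concerns `m = Θ(n)` only).

**Allen–O'Donnell–Witmer 2015 (arXiv:1505.04383), Thm. 2.3** (with Def. 3.1, Def. 3.7): for any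
`k`-ary predicate `P` there is an efficient algorithm that, w.h.p. over `I ∼ F_P(n, p)`, STRONGLY
refutes `I` provided the (expected) number of constraints `m̄ = 2^k n^k p` is at least
`Õ(n^{k/2})`; a refutation algorithm never errs (it outputs "fail" or a correct certificate) and
fails with probability `o(1)` (over the instance and its own coins; randomized algorithms allowed).
For `P = OR_k` (k-SAT) strong refutation (`Opt ≤ 1 - 2^{-k} + o(1)`) is in particular refutation
(`Opt < 1`).

**The random model is AOW's `F_P(n, p)`** (Def. 3.1): each of the `2^k n^k` constraints — an
ORDERED scope `S ∈ [n]^k` (repeated variables allowed) with a negation pattern `c ∈ {±1}^k` — is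
included independently with probability `p`. This is NOT the tree's `randomKCNF k n m`
(`m` i.i.d. clauses on `k` distinct variables); we define AOW's model honestly (`aowKSAT`, via the
product/binomial law `subsetPMF` on sets of constraints) and state the fact for it. (AOW, App. D,
transfer results to the fixed-`m` model; that transfer is not vendored here.)

Rendering: the algorithm is a tree `RandAlg (List Bool) Bool` which is PPT
(`Literature.Computability.Cryptography.IsPPT`), receives `(1ⁿ, encode φ)` (`boolPair (unaryEncodeNat n) ·`,
`encodingCNF`), outputs `true` = "refuted"; soundness: probability `0` of `true` on satisfiable
`φ`; success: `Pr_{φ ∼ aowKSAT k n (p n), coins}[true] → 1` whenever eventually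
`C n^{k/2} (log n)^c ≤ 2^k n^k p(n)`. Nothing is asserted; users take
`(h : allen_odonnell_witmer_kSAT)`.

## References

* S. R. Allen, R. O'Donnell, D. Witmer, *How to refute a random CSP*, FOCS 2015,
  arXiv:1505.04383: Def. 3.1 (`F_P(n,p)`), Def. 3.7 (refutation algorithms), Thm. 2.3
  (strong refutation of any `CSP(P)` with `Õ(n^{k/2})` constraints), Thm. 2.1 (`k`-XOR).
* A. Coja-Oghlan, A. Goerdt, A. Lanka, *Strong refutation heuristics for random `k`-SAT*,
  Combin. Probab. Comput. 16 (2007) (earlier `n^{⌈k/2⌉}` bound).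
-/

noncomputable section

open Filter Topology Computability Literature.Computability.Cryptography

namespace Literature.Computability.Complexity

/-! ### AOW's random model `F_P(n, p)` for `k`-SAT -/

/-- An AOW constraint of arity `k` on `n` variables: an ordered scope `S ∈ [n]^k` (repetitions
allowed) and a negation pattern. [Allen–O'Donnell–Witmer 2015, Def. 3.1] [cite: arXiv150504383, Def. 3.1] -/
abbrev AOWConstraint (k n : ℕ) : Type := (Fin k → Fin n) × (Fin k → Bool)

/-- The clause of a `k`-SAT constraint `(S, c)`: literals `(S i, c i)` in scope order.
[Allen–O'Donnell–Witmer 2015, Def. 3.1 (`P(c ∘ x_S)` with `P = OR_k`)] [cite: arXiv150504383, Def. 3.1] -/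
def AOWConstraint.toClause {k n : ℕ} (C : AOWConstraint k n) : Clause ℕ :=
  List.ofFn fun i => ((C.1 i : ℕ), C.2 i)

/-- The inclusion probability clamped to `[0, 1]`, in `ℝ≥0∞`. [folklore] -/
def clampENNReal (p : ℝ) : ENNReal := ENNReal.ofReal (min p 1)

/-- `clampENNReal p ≤ 1`. [folklore] -/
theorem clampENNReal_le_one (p : ℝ) : clampENNReal p ≤ 1 :=
  ENNReal.ofReal_le_one.2 (min_le_right _ _)

/-- **The binomial / product law on subsets** of a finite type: each element included
independently with probability `p` (clamped to `[0,1]`): `P(T) = p^{|T|} (1-p)^{N-|T|}` (an honest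
`PMF`, total mass `(p + (1-p))^N = 1`). [Allen–O'Donnell–Witmer 2015, Def. 3.1 ("including each …
independently with probability `p`")] [folklore] -/
def subsetPMF (ι : Type) [Fintype ι] (p : ℝ) : PMF (Finset ι) :=
  PMF.ofFintype (fun T => clampENNReal p ^ T.card * (1 - clampENNReal p) ^ (Fintype.card ι - T.card))
    (by rw [Fintype.sum_pow_mul_eq_add_pow, add_tsub_cancel_of_le (clampENNReal_le_one p), one_pow])

/-- **AOW's random `k`-SAT model `F_{OR_k}(n, p)`** as a law on the tree's `CNF ℕ`: a random set of
constraints from `subsetPMF`, listed (in an arbitrary but fixed order, `Finset.toList`) as clauses.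
Expected number of clauses `m̄ = 2^k n^k p`. [Allen–O'Donnell–Witmer 2015, Def. 3.1] [cite: arXiv150504383, Def. 3.1] -/
def aowKSAT (k n : ℕ) (p : ℝ) : PMF (CNF ℕ) :=
  (subsetPMF (AOWConstraint k n) p).map
    fun T : Finset (AOWConstraint k n) => T.toList.map AOWConstraint.toClause

/-- The law of the refuter's verdict on `φ ∼ aowKSAT k n p`: run the randomized algorithm `A` on
`(1ⁿ, encode φ)` with fresh coins. [Allen–O'Donnell–Witmer 2015, Def. 3.7] [cite: arXiv150504383, Def. 3.7] -/
def refuteLaw (A : RandAlg (List Bool) Bool) (k n : ℕ) (p : ℝ) : PMF Bool :=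
  (aowKSAT k n p).bind fun φ => A.outputPMF id (boolPair (unaryEncodeNat n) (encodingCNF.encode φ))

/-- **A sound refuter**: on (the encoding of) a SATISFIABLE formula the algorithm outputs
`true` ("refuted") with probability `0`, whatever the unary parameter. [Allen–O'Donnell–Witmer
2015, Def. 3.7 ("`A` is never allowed to err")] [cite: arXiv150504383, Def. 3.7] -/
def IsSoundRandRefuter (A : RandAlg (List Bool) Bool) : Prop :=
  ∀ φ : CNF ℕ, φ.Satisfiable → ∀ n : ℕ,
    A.outputPMF id (boolPair (unaryEncodeNat n) (encodingCNF.encode φ)) true = 0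

/-! ### The named fact -/

/-- NAMED FACT (**Allen–O'Donnell–Witmer 2015, Thm. 2.3 for `P = OR_k`**, with Defs. 3.1, 3.7):
for every `k ≥ 3` there are constants `C > 0`, `c` and a PPT algorithm `A` which is a sound refuter
and which, for every sequence of inclusion probabilities `p(n) ∈ [0,1]` with eventually
`C · n^{k/2} · (log n)^c ≤ 2^k n^k p(n)` (i.e. `m̄ ≥ Õ(n^{k/2})`), refutes `φ ∼ F_{OR_k}(n, p(n))`
with probability `→ 1`. Users take `(h : allen_odonnell_witmer_kSAT)`.
[Allen–O'Donnell–Witmer 2015, Thm. 2.3 (any `k`-ary `P`, `Õ(n^{k/2})` constraints), Def. 3.7] [cite: arXiv150504383, Thm. 2.3] -/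
def allen_odonnell_witmer_kSAT : Prop :=
  ∀ k : ℕ, 3 ≤ k → ∃ (C c : ℝ) (A : RandAlg (List Bool) Bool), 0 < C ∧ IsPPT A encodeBool ∧
    IsSoundRandRefuter A ∧
      ∀ p : ℕ → ℝ, (∀ n, 0 ≤ p n ∧ p n ≤ 1) →
        (∀ᶠ n : ℕ in atTop,
          C * (n : ℝ) ^ ((k : ℝ) / 2) * Real.log n ^ c ≤ 2 ^ k * (n : ℝ) ^ k * p n) →
        Tendsto (fun n : ℕ => refuteLaw A k n (p n) true) atTop (𝓝 1)

/-! ### API -/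

/-- With inclusion probability `0` the instance is empty. [folklore] -/
theorem subsetPMF_zero_apply_empty (ι : Type) [Fintype ι] :
    subsetPMF ι 0 ∅ = 1 := by
  simp [subsetPMF, PMF.ofFintype_apply, clampENNReal]

/-- The clause of a constraint has exactly `k` literals (possibly with repeated variables).
[Allen–O'Donnell–Witmer 2015, Def. 3.1] [folklore] -/
@[simp] theorem AOWConstraint.length_toClause {k n : ℕ} (C : AOWConstraint k n) :
    C.toClause.length = k := by
  simp [AOWConstraint.toClause]

/-- There are `2^k n^k` constraints. [Allen–O'Donnell–Witmer 2015, Def. 3.1] [folklore] -/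
theorem card_AOWConstraint (k n : ℕ) : Fintype.card (AOWConstraint k n) = n ^ k * 2 ^ k := by
  simp [AOWConstraint, Fintype.card_prod]

/-- The algorithm which never refutes is (trivially) sound — so the content of the fact is the
success clause. [folklore] -/
theorem isSoundRandRefuter_const_false (coinLen : ℕ → ℕ) :
    IsSoundRandRefuter ⟨fun _ _ => false, coinLen⟩ := by
  intro φ _ n
  rw [PMF.apply_eq_zero_iff, RandAlg.outputPMF, PMF.support_map]
  rintro ⟨r, -, hr⟩
  exact Bool.false_ne_true hr

end Literature.Computability.Complexity
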